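import Mathlib
import Summits.ValiantsHypothesis.ValiantsHypothesis.Theorems.NewtonUnitEquationsTwoProductsPowerSumCriterion
/-! # Stub `stub_engineSignTame` — crux `TwoProducts` (stmt-ValiantsHypothesis-5906), line `corner-log-linearization`
   Sign-tame rung of the engine (KPTT "Newton polygon of `f₁⋯f_m + 1`", sign-tame regime): for
   `D = u₀ * ∏ i, (1 - p i) - 1` with `u₀` `t`-sparse, `coeff 0 u₀ = 1`, and `p i` `t`-sparse,
   constant-free with positive real coefficients, the set of south-west vertices (strict minimisers
   of a positive integer weight `ω` over `supp D`) has at most `(n+1)(t+1)²` elements.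
   Peel-and-invert at finite order: `Ψ = ∏ i, ∑_{N<R} (p i)^N` has nonnegative coefficients (no
   cancellation), constant term `1`, and `(∏ (1 - p i)) * Ψ ≡ 1` below weight `R`; hence a strict
   minimiser `e` of `supp D` with `ω e < R` is one of `supp (u₀ - Ψ)`, and peeling one generator
   `g ∈ supp (p i)` off `e ∈ supp Ψ` shows `e ∈ supp u₀ ∪ (supp u₀ + ⋃ supp (p i))`. [folklore] -/
set_option linter.dupNamespace false -- single-conjunct summit: `ValiantsHypothesis.ValiantsHypothesis`
namespace Summit.ValiantsHypothesis.ValiantsHypothesis.Theorems.TwoProducts.SignTame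
open scoped BigOperators ComplexOrder Pointwise
open MvPolynomial
open Summit.ValiantsHypothesis.ValiantsHypothesis.Theorems.TwoProducts.PowerSum

/-- Products of coefficientwise-nonnegative polynomials are coefficientwise nonnegative
(for the star order on `ℂ`). [folklore] -/
theorem coeff_mul_nonneg (A B : MvPolynomial (Fin 2) ℂ) (hA : ∀ e, 0 ≤ coeff e A)
    (hB : ∀ e, 0 ≤ coeff e B) (e : Fin 2 →₀ ℕ) : 0 ≤ coeff e (A * B) := by
  rw [coeff_mul]
  exact Finset.sum_nonneg fun x _ => mul_nonneg (hA x.1) (hB x.2)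

/-- No cancellation: for coefficientwise-nonnegative `A`, `B` one has
`supp A + supp B ⊆ supp (A * B)`. [folklore] -/
theorem add_mem_support_mul (A B : MvPolynomial (Fin 2) ℂ) (hA : ∀ e, 0 ≤ coeff e A)
    (hB : ∀ e, 0 ≤ coeff e B) (a b : Fin 2 →₀ ℕ) (ha : a ∈ A.support) (hb : b ∈ B.support) :
    a + b ∈ (A * B).support := by
  rw [mem_support_iff] at ha hb ⊢
  have hlt : 0 < coeff a A * coeff b B :=
    mul_pos (lt_of_le_of_ne (hA a) (Ne.symm ha)) (lt_of_le_of_ne (hB b) (Ne.symm hb))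
  have hle : coeff a A * coeff b B ≤ coeff (a + b) (A * B) := by
    rw [coeff_mul]
    have hmem : (a, b) ∈ Finset.HasAntidiagonal.antidiagonal (a + b) :=
      Finset.HasAntidiagonal.mem_antidiagonal.mpr rfl
    exact Finset.single_le_sum
      (f := fun x : (Fin 2 →₀ ℕ) × (Fin 2 →₀ ℕ) => coeff x.1 A * coeff x.2 B)
      (fun x _ => mul_nonneg (hA x.1) (hB x.2)) hmem
  exact (lt_of_lt_of_le hlt hle).ne'

/-- Peeling one generator off a nonzero support point is inherited by products of
coefficientwise-nonnegative polynomials. [folklore] -/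
theorem peel_mul (E : Finset (Fin 2 →₀ ℕ)) (A B : MvPolynomial (Fin 2) ℂ)
    (hA : ∀ e, 0 ≤ coeff e A) (hB : ∀ e, 0 ≤ coeff e B)
    (hpA : ∀ e ∈ A.support, e ≠ 0 → ∃ g ∈ E, ∃ e' ∈ A.support, e = e' + g)
    (hpB : ∀ e ∈ B.support, e ≠ 0 → ∃ g ∈ E, ∃ e' ∈ B.support, e = e' + g) :
    ∀ e ∈ (A * B).support, e ≠ 0 → ∃ g ∈ E, ∃ e' ∈ (A * B).support, e = e' + g := by
  intro e he hne
  obtain ⟨a, ha, b, hb, rfl⟩ := Finset.mem_add.mp (support_mul _ _ he)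
  by_cases ha0 : a = 0
  · have hb0 : b ≠ 0 := by
      rintro rfl
      exact hne (by rw [ha0, add_zero])
    obtain ⟨g, hg, b', hb', rfl⟩ := hpB b hb hb0
    exact ⟨g, hg, a + b', add_mem_support_mul A B hA hB a b' ha hb', by rw [add_assoc]⟩
  · obtain ⟨g, hg, a', ha', rfl⟩ := hpA a ha ha0
    exact ⟨g, hg, a' + b, add_mem_support_mul A B hA hB a' b ha' hb, by rw [add_right_comm]⟩

/-- Powers of a coefficientwise-nonnegative polynomial are coefficientwise nonnegative.
[folklore] -/
theorem coeff_pow_nonneg (q : MvPolynomial (Fin 2) ℂ) (hq : ∀ e, 0 ≤ coeff e q) :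
    ∀ (N : ℕ) (e : Fin 2 →₀ ℕ), 0 ≤ coeff e (q ^ N) := by
  intro N
  induction N with
  | zero =>
    intro e
    rw [pow_zero, coeff_one]
    split_ifs
    exacts [zero_le_one, le_rfl]
  | succ N ih =>
    intro e
    rw [pow_succ]
    exact coeff_mul_nonneg _ _ ih hq e

/-- Truncated geometric series of a coefficientwise-nonnegative polynomial are coefficientwise
nonnegative. [folklore] -/
theorem coeff_geom_nonneg (q : MvPolynomial (Fin 2) ℂ) (hq : ∀ e, 0 ≤ coeff e q) (R : ℕ)
    (e : Fin 2 →₀ ℕ) : 0 ≤ coeff e (∑ N ∈ Finset.range R, q ^ N) := by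
  rw [coeff_sum]
  exact Finset.sum_nonneg fun N _ => coeff_pow_nonneg q hq N e

/-- No cancellation in a truncated geometric series: `supp (q ^ N) ⊆ supp (∑_{N<R} q ^ N)` for
`N < R`. [folklore] -/
theorem mem_support_geom_of_mem_support_pow (q : MvPolynomial (Fin 2) ℂ)
    (hq : ∀ e, 0 ≤ coeff e q) (R N : ℕ) (hN : N < R) (e : Fin 2 →₀ ℕ)
    (he : e ∈ (q ^ N).support) : e ∈ (∑ N ∈ Finset.range R, q ^ N).support := by
  rw [mem_support_iff] at he ⊢
  have hlt : 0 < coeff e (q ^ N) := lt_of_le_of_ne (coeff_pow_nonneg q hq N e) (Ne.symm he)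
  have hle : coeff e (q ^ N) ≤ coeff e (∑ N ∈ Finset.range R, q ^ N) := by
    rw [coeff_sum]
    exact Finset.single_le_sum (f := fun N => coeff e (q ^ N))
      (fun N _ => coeff_pow_nonneg q hq N e) (Finset.mem_range.mpr hN)
  exact (lt_of_lt_of_le hlt hle).ne'

/-- Peeling for a truncated geometric series: a nonzero support point of `∑_{N<R} q ^ N` is a
support point plus a support point of `q`. [folklore] -/
theorem peel_geom (E : Finset (Fin 2 →₀ ℕ)) (q : MvPolynomial (Fin 2) ℂ)
    (hq : ∀ e, 0 ≤ coeff e q) (hqE : q.support ⊆ E) (R : ℕ) :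
    ∀ e ∈ (∑ N ∈ Finset.range R, q ^ N).support, e ≠ 0 →
      ∃ g ∈ E, ∃ e' ∈ (∑ N ∈ Finset.range R, q ^ N).support, e = e' + g := by
  intro e he hne
  obtain ⟨N, hN, heN⟩ := Finset.mem_biUnion.mp (support_sum he)
  rw [Finset.mem_range] at hN
  obtain _ | N := N
  · exfalso
    rw [pow_zero, mem_support_iff, coeff_one] at heN
    split_ifs at heN with h
    · exact hne h.symm
    · exact heN rfl
  · rw [pow_succ] at heN
    obtain ⟨a, ha, g, hg, rfl⟩ := Finset.mem_add.mp (support_mul _ _ heN)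
    exact ⟨g, hqE hg, a, mem_support_geom_of_mem_support_pow q hq R N (by omega) a ha, rfl⟩

/-- The finite-order inverse `Ψ = ∏ i, ∑_{N<R} (p i)^N` of `∏ (1 - p i)` for coefficientwise
nonnegative `p i`: it is coefficientwise nonnegative, and every nonzero support point of `Ψ` is a
support point of `Ψ` plus a support point of some `p i`. [folklore] -/
theorem prod_geom_nonneg_peel {n : ℕ} (p : Fin n → MvPolynomial (Fin 2) ℂ)
    (hp : ∀ i e, 0 ≤ coeff e (p i)) (R : ℕ) :
    (∀ e, 0 ≤ coeff e (∏ i, ∑ N ∈ Finset.range R, p i ^ N)) ∧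
      ∀ e ∈ (∏ i, ∑ N ∈ Finset.range R, p i ^ N).support, e ≠ 0 →
        ∃ g ∈ Finset.univ.biUnion (fun i => (p i).support),
          ∃ e' ∈ (∏ i, ∑ N ∈ Finset.range R, p i ^ N).support, e = e' + g := by
  refine Finset.prod_induction (fun i => ∑ N ∈ Finset.range R, p i ^ N)
    (fun F => (∀ e, 0 ≤ coeff e F) ∧ ∀ e ∈ F.support, e ≠ 0 →
      ∃ g ∈ Finset.univ.biUnion (fun i => (p i).support), ∃ e' ∈ F.support, e = e' + g)
    ?_ ?_ ?_
  · rintro A B ⟨hA, hpA⟩ ⟨hB, hpB⟩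
    exact ⟨coeff_mul_nonneg A B hA hB, peel_mul _ A B hA hB hpA hpB⟩
  · refine ⟨fun e => ?_, fun e he hne => ?_⟩
    · rw [coeff_one]
      split_ifs
      exacts [zero_le_one, le_rfl]
    · exfalso
      rw [mem_support_iff, coeff_one] at he
      split_ifs at he with h
      · exact hne h.symm
      · exact he rfl
  · intro i _
    exact ⟨coeff_geom_nonneg (p i) (hp i) R, peel_geom _ (p i) (hp i)
      (Finset.subset_biUnion_of_mem (fun i => (p i).support) (Finset.mem_univ i)) R⟩

/-- Inverse below weight `R`: `(∏ (1 - p i)) * ∏ ∑_{N<R} (p i)^N ≡ 1` below `R` for constant-free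
`p i`. [folklore] -/
theorem coeff_prod_one_sub_mul_geom (ω : (Fin 2 →₀ ℕ) → ℤ) (hadd : ∀ p q, ω (p + q) = ω p + ω q)
    (hpos : ∀ p, p ≠ 0 → 1 ≤ ω p) {n : ℕ} (p : Fin n → MvPolynomial (Fin 2) ℂ)
    (hp0 : ∀ i, coeff 0 (p i) = 0) (R : ℕ) :
    ∀ q, ω q < (R : ℤ) →
      coeff q ((∏ i, (1 - p i)) * ∏ i, ∑ N ∈ Finset.range R, p i ^ N) = coeff q 1 := by
  have key : ∀ s : Finset (Fin n), ∀ q, ω q < (R : ℤ) →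
      coeff q (∏ i ∈ s, (1 - p i ^ R)) = coeff q 1 := by
    intro s
    induction s using Finset.induction_on with
    | empty =>
      intro q _
      rw [Finset.prod_empty]
    | insert a s ha ih =>
      intro q hq
      rw [Finset.prod_insert ha]
      have h := coeff_mul_congr_below ω hadd hpos R (1 - p a ^ R) 1 (∏ i ∈ s, (1 - p i ^ R)) 1
        (fun q' hq' => by
          rw [coeff_sub, coeff_pow_eq_zero_below ω hadd hpos _ (hp0 a) R q' hq', sub_zero])
        ih q hq
      rwa [mul_one] at h
  intro q hq
  have hprod : (∏ i, (1 - p i)) * ∏ i, ∑ N ∈ Finset.range R, p i ^ N = ∏ i, (1 - p i ^ R) := by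
    rw [← Finset.prod_mul_distrib]
    exact Finset.prod_congr rfl fun i _ => mul_neg_geom_sum (p i) R
  rw [hprod]
  exact key Finset.univ q hq

/-- Peel-and-invert transfer: a strict `ω`-minimiser `e` of `supp (u₀ * ∏ (1 - p i) - 1)` with
`ω e < R` is a strict `ω`-minimiser of `supp (u₀ - Ψ)`, `Ψ = ∏ i, ∑_{N<R} (p i)^N`, provided
`coeff 0 Ψ = 1`. [folklore] -/
theorem strictMin_sub_geom_of_strictMin (ω : (Fin 2 →₀ ℕ) → ℤ)
    (hadd : ∀ p q, ω (p + q) = ω p + ω q) (hpos : ∀ p, p ≠ 0 → 1 ≤ ω p) {n : ℕ}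
    (u₀ : MvPolynomial (Fin 2) ℂ) (p : Fin n → MvPolynomial (Fin 2) ℂ)
    (hp0 : ∀ i, coeff 0 (p i) = 0) (R : ℕ)
    (hΨ0 : coeff 0 (∏ i, ∑ N ∈ Finset.range R, p i ^ N) = 1) (e : Fin 2 →₀ ℕ)
    (he : ω e < (R : ℤ))
    (h : e ∈ (u₀ * ∏ i, (1 - p i) - 1).support ∧
      ∀ e' ∈ (u₀ * ∏ i, (1 - p i) - 1).support, e' ≠ e → ω e < ω e') :
    e ∈ (u₀ - ∏ i, ∑ N ∈ Finset.range R, p i ^ N).support ∧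
      ∀ e' ∈ (u₀ - ∏ i, ∑ N ∈ Finset.range R, p i ^ N).support, e' ≠ e → ω e < ω e' := by
  have h1 := (strictMin_transfer ω (u₀ * ∏ i, (1 - p i) - 1)
      ((u₀ * ∏ i, (1 - p i) - 1) * ∏ i, ∑ N ∈ Finset.range R, p i ^ N)
      (fun q hq => exists_support_left_of_mem_support_mul ω hadd hpos _ _ q hq)
      (fun q hq hmin => by
        rw [mem_support_iff, coeff_mul_of_isMin ω hadd hpos _ _ q hmin, hΨ0, mul_one]
        exact mem_support_iff.mp hq) e).mpr h
  refine strictMin_of_congr_below ω _ _ R (fun q hq => ?_) e he h1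
  rw [sub_mul, one_mul, mul_assoc, coeff_sub, coeff_sub,
    coeff_mul_congr_below ω hadd hpos R u₀ u₀ _ 1 (fun _ _ => rfl)
      (coeff_prod_one_sub_mul_geom ω hadd hpos p hp0 R) q hq, mul_one]

/-- Exchange step: a strict `ω`-minimiser of `supp (u - Ψ)`, where `coeff 0 u ≠ 0` and every
nonzero support point of `Ψ` peels into a support point of `Ψ` plus an element of `E ∌ 0`, lies
in `supp u ∪ (supp u + E)`. [folklore] -/
theorem mem_of_strictMin_sub (ω : (Fin 2 →₀ ℕ) → ℤ) (hadd : ∀ p q, ω (p + q) = ω p + ω q)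
    (hpos : ∀ p, p ≠ 0 → 1 ≤ ω p) (E : Finset (Fin 2 →₀ ℕ)) (hE0 : (0 : Fin 2 →₀ ℕ) ∉ E)
    (u Ψ : MvPolynomial (Fin 2) ℂ) (hu0 : coeff 0 u ≠ 0)
    (hpeel : ∀ e ∈ Ψ.support, e ≠ 0 → ∃ g ∈ E, ∃ e' ∈ Ψ.support, e = e' + g) (e : Fin 2 →₀ ℕ)
    (h : e ∈ (u - Ψ).support ∧ ∀ e' ∈ (u - Ψ).support, e' ≠ e → ω e < ω e') :
    e ∈ u.support ∪ (u.support + E) := by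
  obtain ⟨he, hmin⟩ := h
  rw [Finset.mem_union]
  by_cases heu : e ∈ u.support
  · exact Or.inl heu
  right
  have heΨ : e ∈ Ψ.support := by
    rw [mem_support_iff] at he ⊢
    rwa [coeff_sub, notMem_support_iff.mp heu, zero_sub, neg_ne_zero] at he
  have hne : e ≠ 0 := by
    rintro rfl
    exact heu (mem_support_iff.mpr hu0)
  obtain ⟨g, hg, e', he', rfl⟩ := hpeel e heΨ hne
  refine Finset.add_mem_add ?_ hg
  by_contra he'u
  have he'D : e' ∈ (u - Ψ).support := by
    rw [mem_support_iff, coeff_sub, notMem_support_iff.mp he'u, zero_sub, neg_ne_zero]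
    exact mem_support_iff.mp he'
  have hg0 : g ≠ 0 := fun h0 => hE0 (h0 ▸ hg)
  have hlt := hmin e' he'D (fun h' => hg0 (left_eq_add.mp h'))
  rw [hadd] at hlt
  linarith [hpos g hg0]

/-- One south-west vertex: a strict minimiser of an additive weight `ω ≥ 1` over
`supp (u₀ * ∏ (1 - p i) - 1)` (sign-tame data) lies in `supp u₀ ∪ (supp u₀ + ⋃ supp (p i))`.
[folklore] -/
theorem sw_vertex_mem (ω : (Fin 2 →₀ ℕ) → ℤ) (hadd : ∀ p q, ω (p + q) = ω p + ω q)
    (hpos : ∀ p, p ≠ 0 → 1 ≤ ω p) {n : ℕ} (u₀ : MvPolynomial (Fin 2) ℂ)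
    (p : Fin n → MvPolynomial (Fin 2) ℂ) (hu0 : coeff 0 u₀ = 1) (hp0 : ∀ i, coeff 0 (p i) = 0)
    (hp : ∀ i e, 0 ≤ coeff e (p i)) (e : Fin 2 →₀ ℕ)
    (h : e ∈ (u₀ * ∏ i, (1 - p i) - 1).support ∧
      ∀ e' ∈ (u₀ * ∏ i, (1 - p i) - 1).support, e' ≠ e → ω e < ω e') :
    e ∈ u₀.support ∪ (u₀.support + Finset.univ.biUnion fun i => (p i).support) := by
  obtain ⟨R, hR0, heR⟩ : ∃ R : ℕ, R ≠ 0 ∧ ω e < (R : ℤ) :=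
    ⟨(ω e).toNat + 1, by omega, by push_cast; linarith [Int.self_le_toNat (ω e)]⟩
  have hG0 : ∀ i, coeff 0 (∑ N ∈ Finset.range R, p i ^ N) = 1 := by
    intro i
    rw [← constantCoeff_eq, map_sum]
    simp_rw [map_pow, constantCoeff_eq, hp0 i]
    rw [zero_geom_sum, if_neg hR0]
  have hΨ0 : coeff 0 (∏ i, ∑ N ∈ Finset.range R, p i ^ N) = 1 :=
    coeff_zero_prod_eq_one (fun i => ∑ N ∈ Finset.range R, p i ^ N) hG0
  have hE0 : (0 : Fin 2 →₀ ℕ) ∉ Finset.univ.biUnion fun i => (p i).support := by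
    intro h0
    obtain ⟨i, -, hi⟩ := Finset.mem_biUnion.mp h0
    exact (mem_support_iff.mp hi) (hp0 i)
  exact mem_of_strictMin_sub ω hadd hpos _ hE0 u₀ _ (by rw [hu0]; exact one_ne_zero)
    (prod_geom_nonneg_peel p hp R).2 e
    (strictMin_sub_geom_of_strictMin ω hadd hpos u₀ p hp0 R hΨ0 e heR h)

/-- **Sign-tame rung of the engine.** For `D = u₀ * ∏ i, (1 - p i) - 1` with `u₀` `t`-sparse,
`coeff 0 u₀ = 1`, and each `p i` `t`-sparse, constant-free, with positive real coefficients, the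
south-west vertices of `supp D` (strict minimisers of some positive integer weight) number at
most `(n + 1) (t + 1)²`: they lie in `supp u₀ ∪ (supp u₀ + ⋃ supp (p i))`. [folklore] -/
theorem stub_engineSignTame : ∀ (n t : ℕ) (u₀ : MvPolynomial (Fin 2) ℂ) (p : Fin n → MvPolynomial (Fin 2) ℂ), u₀.support.card ≤ t → MvPolynomial.coeff 0 u₀ = 1 → (∀ i, (p i).support.card ≤ t) → (∀ i, MvPolynomial.coeff 0 (p i) = 0) → (∀ i, ∀ e ∈ (p i).support, ∃ r : ℝ, 0 < r ∧ MvPolynomial.coeff e (p i) = (r : ℂ)) → ({e : Fin 2 →₀ ℕ | ∃ w : Fin 2 → ℤ, 0 < w 0 ∧ 0 < w 1 ∧ ((e) ∈ ((u₀ * ∏ i, (1 - p i) - 1).support) ∧ ∀ e' ∈ ((u₀ * ∏ i, (1 - p i) - 1).support), e' ≠ (e) → ((w) 0 * ((e) 0 : ℤ) + (w) 1 * ((e) 1 : ℤ)) < ((w) 0 * ((e') 0 : ℤ) + (w) 1 * ((e') 1 : ℤ)))}).ncard ≤ (n + 1) * (t + 1) ^ 2 := by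
  intro n t u₀ p hu hu0 hpt hp0 hpos
  have hp : ∀ i e, 0 ≤ coeff e (p i) := by
    intro i e
    by_cases he : e ∈ (p i).support
    · obtain ⟨r, hr, h⟩ := hpos i e he
      rw [h]
      exact_mod_cast hr.le
    · rw [notMem_support_iff.mp he]
  have hEcard : (Finset.univ.biUnion fun i => (p i).support).card ≤ n * t := by
    refine Finset.card_biUnion_le.trans ?_
    refine (Finset.sum_le_sum fun i _ => hpt i).trans ?_
    rw [Finset.sum_const, Finset.card_univ, Fintype.card_fin, smul_eq_mul]
  have hsub : {e : Fin 2 →₀ ℕ | ∃ w : Fin 2 → ℤ, 0 < w 0 ∧ 0 < w 1 ∧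
      ((e) ∈ ((u₀ * ∏ i, (1 - p i) - 1).support) ∧
        ∀ e' ∈ ((u₀ * ∏ i, (1 - p i) - 1).support), e' ≠ (e) →
          ((w) 0 * ((e) 0 : ℤ) + (w) 1 * ((e) 1 : ℤ)) <
            ((w) 0 * ((e') 0 : ℤ) + (w) 1 * ((e') 1 : ℤ)))} ⊆
      ↑(u₀.support ∪ (u₀.support + Finset.univ.biUnion fun i => (p i).support)) := by
    rintro e ⟨w, hw0, hw1, h⟩
    have hadd : ∀ p q : Fin 2 →₀ ℕ,
        w 0 * ((p + q) 0 : ℤ) + w 1 * ((p + q) 1 : ℤ) =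
          (w 0 * (p 0 : ℤ) + w 1 * (p 1 : ℤ)) + (w 0 * (q 0 : ℤ) + w 1 * (q 1 : ℤ)) := by
      intro p q
      simp only [Finsupp.coe_add, Pi.add_apply]
      push_cast
      ring
    exact sw_vertex_mem (fun q : Fin 2 →₀ ℕ => w 0 * (q 0 : ℤ) + w 1 * (q 1 : ℤ)) hadd
      (one_le_wt_of_ne_zero w hw0 hw1) u₀ p hu0 hp0 hp e h
  calc _ ≤ (↑(u₀.support ∪ (u₀.support + Finset.univ.biUnion fun i => (p i).support)) :
          Set (Fin 2 →₀ ℕ)).ncard := Set.ncard_le_ncard hsub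
    _ = (u₀.support ∪ (u₀.support + Finset.univ.biUnion fun i => (p i).support)).card :=
        Set.ncard_coe_finset _
    _ ≤ u₀.support.card +
          u₀.support.card * (Finset.univ.biUnion fun i => (p i).support).card :=
        (Finset.card_union_le _ _).trans (Nat.add_le_add_left Finset.card_add_le _)
    _ ≤ t + t * (n * t) := Nat.add_le_add hu (Nat.mul_le_mul hu hEcard)
    _ ≤ (n + 1) * (t + 1) ^ 2 := by nlinarith

end Summit.ValiantsHypothesis.ValiantsHypothesis.Theorems.TwoProducts.SignTame
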